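import Mathlib
import HarnessLib
import Summits.ValiantsHypothesis.ValiantsHypothesis.Theorems.BarrierLeverPartitionMinorsHitByVPHiddenStatesCapacity

/-!
# Route BarrierLever — item `PartitionMinorsHitByVP` (stmt-ValiantsHypothesis-19717):
# REFUTATION of the capacity conjecture `DownsetCapacitySufficiency` (the prism / even-cycle obstruction)

Helper file (`--supports stmt-ValiantsHypothesis-19717`; cell valiant-natproofs, rung V4, 𝒟-side of door (c); prover seat
val-np-p3 gen 7, the author of the conjecture, killing it one hour after filing — its kit falsifier j284128 found the
configurations, the mechanism below is by hand). Definition-free apart from the explicit counterexample data. Closes NO item.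

**Counterexample (`h = K = 5`, `r = 10`).** Hidden family `e` = the PRISM `B₁({0,1,2,3}) × {∅,{4}}`
(`∅,{0},{1},{2},{3}` and the same sets with `4` added) — injective, down-closed, `#{k : |e k| ≤ t} = 1, 6, 10`.
Column family `u = {∅,{0},{1},{2},{3},{4},{0,1},{1,2},{2,3},{0,3}}` — injective, hereditary capacities hold
(`prism_downCapacity`, by `decide`). Yet the additive matrix is singular for EVERY table (`det_prism_eq_zero`):
writing `ℓ_a(top j) = α_a(j) + c_a` (`c_a = t(4,a)`), the top-minus-bottom differences of the rows are `0` (row `∅`),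
`c_a·𝟙` (row `{a}`) and `c_aα_b + c_bα_a + c_ac_b·𝟙` (row `{a,b}`), all in the row space of the `5 × 5` matrix
`S = P·T` with `P = 1 ⊕ N`, `N` the `c`-weighted UNSIGNED incidence matrix of the 4-cycle `0–1–2–3–0`, whose determinant
vanishes identically (even cycle). A kernel vector `θ` of `S` lifts to the kernel vector `(−θ, θ)` of the `10 × 10` matrix.

* `not_downsetCapacitySufficiency : ¬ DownsetCapacitySufficiency`.

LESSON (cell record): hereditary degree capacities are necessary but NOT sufficient for goodness; the degree-2 symbols of
products of generic affine functions on a prism are weighted unsigned incidence vectors, so bipartite pair-graphs with a cycle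
are dependent although counting allows them (symmetric-shifting / hyperconnectivity-type matroids govern goodness). Ball–colex
families are not prisms; Conjecture Q\* (`BallGood`, exhaustively verified for `h ≤ 5`) and the door of record are unaffected, and
the kernel arrow `partitionMinorsHitByVP_of_capacitySufficiency` is valid but vacuous.

WHAT THIS IS NOT: nothing here bears on Q\*, CPM, crux 14610 or VP ≠ VNP.
-/

set_option linter.dupNamespace false

namespace Summit.ValiantsHypothesis.ValiantsHypothesis.Theorems.BarrierLever.HiddenStates

open Finset Matrix

noncomputable section

/-! ## 1. The counterexample data -/

/-- Column family of the counterexample: `∅`, the five singletons, and the 4-cycle of pairs `01, 12, 23, 03`. -/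
def prismU : Fin 10 → Finset (Fin 5) :=
  ![∅, {0}, {1}, {2}, {3}, {4}, {0, 1}, {1, 2}, {2, 3}, {0, 3}]

/-- Hidden family of the counterexample: the prism `B₁({0,1,2,3}) × {∅, {4}}` (bottom copy first, then top copy). -/
def prismE : Fin 10 → Finset (Fin 5) :=
  ![∅, {0}, {1}, {2}, {3}, {4}, {0, 4}, {1, 4}, {2, 4}, {3, 4}]

/-- The column family is injective. -/
theorem prismU_injective : Function.Injective prismU := by
  unfold prismU; decide

/-- The hidden family is injective. -/
theorem prismE_injective : Function.Injective prismE := by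
  unfold prismE; decide

/-- The prism is down-closed. -/
theorem prismE_downClosed (k : Fin 10) (J : Finset (Fin 5)) (hJ : J ⊆ prismE k) : J ∈ Set.range prismE := by
  have h : ∀ k : Fin 10, ∀ J ∈ (prismE k).powerset, ∃ k', prismE k' = J := by
    unfold prismE; decide
  obtain ⟨k', hk'⟩ := h k J (Finset.mem_powerset.mpr hJ)
  exact ⟨k', hk'⟩

/-- The hereditary capacity inequalities hold for the counterexample. -/
theorem prism_downCapacity : DownCapacity prismU prismE := by
  intro A t
  rcases Nat.lt_or_ge t 2 with ht | ht
  · interval_cases t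
    · revert A; unfold prismU prismE; decide
    · revert A; unfold prismU prismE; decide
  · have hall : (Finset.univ.filter fun k : Fin 10 => (prismE k).card ≤ t) = Finset.univ := by
      refine Finset.filter_true_of_mem fun k _ => le_trans ?_ ht
      revert k; unfold prismE; decide
    rw [hall]
    exact Finset.card_filter_le _ _

/-! ## 2. The additive matrix of the prism is singular for every table -/

section Det

variable (tx : Option (Fin 5) → Fin 5 → ℂ)

/-- Bottom values `α_a(j) = ℓ_a(e j)`, `j < 5`. -/
def prismα (a : Fin 5) (j : Fin 5) : ℂ := tx none a + ∑ q ∈ prismE (Fin.castAdd 5 j), tx (some q) a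

/-- Top increments `c_a = t(4, a)`. -/
def prismC (a : Fin 5) : ℂ := tx (some 4) a

/-- Top values are bottom values plus the increment. -/
theorem prism_top_eq (a : Fin 5) (j : Fin 5) :
    tx none a + ∑ q ∈ prismE (Fin.natAdd 5 j), tx (some q) a = prismα tx a j + prismC tx a := by
  fin_cases j <;> simp [prismα, prismC, prismE, add_assoc]

/-- The `5 × 5` matrix `S`: the all-ones row and the weighted unsigned incidence rows of the 4-cycle. -/
def prismS : Matrix (Fin 5) (Fin 5) ℂ :=
  Matrix.of ![fun _ => 1,
    fun j => prismC tx 1 * prismα tx 0 j + prismC tx 0 * prismα tx 1 j,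
    fun j => prismC tx 2 * prismα tx 1 j + prismC tx 1 * prismα tx 2 j,
    fun j => prismC tx 3 * prismα tx 2 j + prismC tx 2 * prismα tx 3 j,
    fun j => prismC tx 3 * prismα tx 0 j + prismC tx 0 * prismα tx 3 j]

/-- `P = 1 ⊕ N`, `N` the weighted unsigned incidence matrix of the 4-cycle. -/
def prismP : Matrix (Fin 5) (Fin 5) ℂ :=
  !![1, 0, 0, 0, 0;
     0, prismC tx 1, prismC tx 0, 0, 0;
     0, 0, prismC tx 2, prismC tx 1, 0;
     0, 0, 0, prismC tx 3, prismC tx 2;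
     0, prismC tx 3, 0, 0, prismC tx 0]

/-- `T`: the all-ones row and the rows `α_0, …, α_3`. -/
def prismT : Matrix (Fin 5) (Fin 5) ℂ :=
  Matrix.of ![fun _ => 1, fun j => prismα tx 0 j, fun j => prismα tx 1 j, fun j => prismα tx 2 j, fun j => prismα tx 3 j]

/-- `S = P · T`. -/
theorem prismS_eq : prismS tx = prismP tx * prismT tx := by
  ext i j
  fin_cases i <;> simp [prismS, prismP, prismT, Matrix.mul_apply, Fin.sum_univ_five]

/-- The even cycle: `det P = det N = 0` identically. -/
theorem det_prismP : (prismP tx).det = 0 := by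
  simp [prismP, Matrix.det_succ_row_zero, Fin.sum_univ_succ, Fin.succAbove]
  ring

/-- Hence `det S = 0`. -/
theorem det_prismS : (prismS tx).det = 0 := by
  rw [prismS_eq, Matrix.det_mul, det_prismP, zero_mul]

/-- Coefficients expressing the top-minus-bottom row differences in terms of the rows of `S`. -/
def prismW : Fin 10 → Fin 5 → ℂ :=
  ![![0, 0, 0, 0, 0],
    ![prismC tx 0, 0, 0, 0, 0], ![prismC tx 1, 0, 0, 0, 0], ![prismC tx 2, 0, 0, 0, 0], ![prismC tx 3, 0, 0, 0, 0],
    ![prismC tx 4, 0, 0, 0, 0],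
    ![prismC tx 0 * prismC tx 1, 1, 0, 0, 0], ![prismC tx 1 * prismC tx 2, 0, 1, 0, 0],
    ![prismC tx 2 * prismC tx 3, 0, 0, 1, 0], ![prismC tx 0 * prismC tx 3, 0, 0, 0, 1]]

/-- The numeric additive matrix of the counterexample. -/
def prismM : Matrix (Fin 10) (Fin 10) ℂ :=
  Matrix.of fun i k : Fin 10 => ∏ a ∈ prismU i, (tx none a + ∑ q ∈ prismE k, tx (some q) a)

/-- Row differences top − bottom lie in the row space of `S`: `M i (top j) − M i (bottom j) = Σ_m W i m · S m j`. -/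
theorem prism_row_diff (i : Fin 10) (j : Fin 5) :
    prismM tx i (Fin.natAdd 5 j) - prismM tx i (Fin.castAdd 5 j) = ∑ m : Fin 5, prismW tx i m * prismS tx m j := by
  have hbot : ∀ a : Fin 5, tx none a + ∑ q ∈ prismE (Fin.castAdd 5 j), tx (some q) a = prismα tx a j := fun a => rfl
  have htop := prism_top_eq tx
  simp only [prismM, Matrix.of_apply]
  rw [Finset.prod_congr rfl fun a _ => htop a j, Finset.prod_congr rfl fun a _ => hbot a]
  fin_cases i <;> simp [prismU, prismW, prismS, Fin.sum_univ_five] <;> ring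

/-- **The additive matrix of the prism counterexample is singular for every table.** -/
theorem det_prism_eq_zero : (prismM tx).det = 0 := by
  obtain ⟨θ, hθ, hSθ⟩ := Matrix.exists_mulVec_eq_zero_iff.mpr (det_prismS tx)
  have hS : ∀ m : Fin 5, ∑ j : Fin 5, prismS tx m j * θ j = 0 := fun m => by
    have := congrFun hSθ m
    simpa [Matrix.mulVec, dotProduct] using this
  let θ' : Fin 10 → ℂ := fun k => Fin.addCases (fun j => -θ j) (fun j => θ j) k
  have hθ'l : ∀ j : Fin 5, θ' (Fin.castAdd 5 j) = -θ j := fun j => by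
    show Fin.addCases (fun j => -θ j) (fun j => θ j) (Fin.castAdd 5 j) = -θ j
    rw [Fin.addCases_left]
  have hθ'r : ∀ j : Fin 5, θ' (Fin.natAdd 5 j) = θ j := fun j => by
    show Fin.addCases (fun j => -θ j) (fun j => θ j) (Fin.natAdd 5 j) = θ j
    rw [Fin.addCases_right]
  refine Matrix.exists_mulVec_eq_zero_iff.mp ⟨θ', ?_, ?_⟩
  · intro hzero
    apply hθ
    funext j
    have := congrFun hzero (Fin.natAdd 5 j)
    rw [hθ'r] at this
    exact this
  · funext i
    change ∑ k : Fin (5 + 5), prismM tx i k * θ' k = 0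
    rw [Fin.sum_univ_add]
    simp only [hθ'l, hθ'r]
    have key : ∑ j : Fin 5, (prismM tx i (Fin.natAdd 5 j) - prismM tx i (Fin.castAdd 5 j)) * θ j = 0 := by
      simp_rw [prism_row_diff, Finset.sum_mul]
      rw [Finset.sum_comm]
      refine Finset.sum_eq_zero fun m _ => ?_
      simp_rw [mul_assoc, ← Finset.mul_sum, hS m, mul_zero]
    have hre : ∑ j : Fin 5, prismM tx i (Fin.castAdd 5 j) * -θ j + ∑ j : Fin 5, prismM tx i (Fin.natAdd 5 j) * θ j =
        ∑ j : Fin 5, (prismM tx i (Fin.natAdd 5 j) - prismM tx i (Fin.castAdd 5 j)) * θ j := by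
      rw [← Finset.sum_add_distrib]
      exact Finset.sum_congr rfl fun j _ => by ring
    rw [hre, key]

end Det

/-! ## 3. The refutation -/

/-- **Conjecture HCAP is false**: the prism counterexample satisfies every hypothesis of `DownsetCapacitySufficiency`
but its symbolic additive matrix is singular (no table makes it nonsingular). -/
theorem not_downsetCapacitySufficiency : ¬ DownsetCapacitySufficiency := by
  intro H
  have hgood := H 5 5 10 prismU prismE prismU_injective prismE_injective prismE_downClosed prism_downCapacity
  obtain ⟨tx, htx⟩ := exists_table_of_symbGood prismU prismE hgood
  exact htx (det_prism_eq_zero tx)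

end

end Summit.ValiantsHypothesis.ValiantsHypothesis.Theorems.BarrierLever.HiddenStates
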